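import Mathlib
import HarnessLib

/-!
# Crux `GrenetZeon.PolySizeQPAlgebra` (stmt-ValiantsHypothesis-8064), line `vbp-slice-dealg` —
# second-order expansion of a determinant at the block normal form `diag(1, S)`, `S ∈ Mat₂`

Pure matrix algebra over a commutative ring `T` containing two elements `ε, η` with `ε² = η² = 0`
(the jet ring `R[η][ε]` of `…TaylorTwo` is the intended instance).  For the residual-corank-two case
of the type-independent local Hessian bound (memo of hand 6-g2 on the 8064 ledger item: FACT 1/2) one
needs the `εη`-coefficient of `det (diag(1_κ, S) + ε X + η Y)` with `det S = 0`; this file computes the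
whole determinant in closed form:

* `sqz_mul_sqz`, `epsEta_smul_mul_sqz`, `sqz_mul_epsEta_smul` — products of first-order matrices
  `ε P + η Q` are `εη (P₁ Q₂ + Q₁ P₂)`; a further first-order factor kills them.
* `det_one_add_sqz` — `det (1 + ε P + η Q) = (1 + ε tr P)(1 + η tr Q)(1 - εη tr(PQ))`
  (factorisation into three `det (1 + r M)`, `r² = 0`, and Mathlib's `Matrix.det_one_add_smul`).
* `det_add_fin_two`, `det_sqz_fin_two` — `2 × 2` identities.
* `det_block_sqz` — **the block formula**: with `τ(X) = tr X₁₁`, `ζ(X) = tr(adj S · X₂₂)`,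
  `det (fromBlocks (1 + εX₁₁ + ηY₁₁) (εX₁₂ + ηY₁₂) (εX₂₁ + ηY₂₁) (S + εX₂₂ + ηY₂₂))
     = ε ζ(X) + η ζ(Y) + εη [tr(adj X₂₂ · Y₂₂) - tr(adj S · (X₂₁ Y₁₂ + Y₂₁ X₁₂)) + τ(X) ζ(Y) + τ(Y) ζ(X)]`
  — Schur complement (`Matrix.det_fromBlocks₁₁`, the unipotent block inverted by `1 - E + E²`).
  The four `εη`-terms are the memo's `T₅, T₃ + T₄, T₁, T₂`; their read-outs are bounded in rank by the
  graph lemma (`…CorankTwoForms`) and `AL(2)` (`…AdjugateLengthTwo`).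

HONEST FRAMING: matrix identities; no stub of the line is closed; VP ≠ VNP is not moved.

References: T. Mignon, N. Ressayre, IMRN 2004:79, §2 [MignonRessayre2004].
-/

noncomputable section

open Matrix

-- single-conjunct layout `Summits/ValiantsHypothesis/ValiantsHypothesis`: duplicated namespace by design
set_option linter.dupNamespace false

namespace Summit.ValiantsHypothesis.ValiantsHypothesis.Theorems.GrenetZeonPolySizeQPAlgebra

section SquareZero

variable {T : Type*} [CommRing T] {ε η : T}
variable {l m n : Type*} [Fintype m]

/-- **Product of two first-order matrices**: `(ε P₁ + η Q₁)(ε P₂ + η Q₂) = εη (P₁ Q₂ + Q₁ P₂)` when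
`ε² = η² = 0`. [folklore] -/
theorem sqz_mul_sqz (hε : ε * ε = 0) (hη : η * η = 0) (P₁ Q₁ : Matrix l m T) (P₂ Q₂ : Matrix m n T) :
    (ε • P₁ + η • Q₁) * (ε • P₂ + η • Q₂) = (ε * η) • (P₁ * Q₂ + Q₁ * P₂) := by
  simp only [Matrix.add_mul, Matrix.mul_add, Matrix.smul_mul, Matrix.mul_smul, smul_add, smul_smul,
    hε, hη, zero_smul, zero_add, add_zero]
  rw [mul_comm η ε, add_comm]

/-- A second-order matrix times a first-order one vanishes when `ε² = η² = 0`. [folklore] -/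
theorem epsEta_smul_mul_sqz (hε : ε * ε = 0) (hη : η * η = 0) (M : Matrix l m T)
    (P Q : Matrix m n T) : ((ε * η) • M) * (ε • P + η • Q) = 0 := by
  rw [Matrix.mul_add, Matrix.smul_mul, Matrix.smul_mul, Matrix.mul_smul, Matrix.mul_smul, smul_smul,
    smul_smul]
  have h1 : ε * η * ε = 0 := by rw [mul_right_comm, hε, zero_mul]
  have h2 : ε * η * η = 0 := by rw [mul_assoc, hη, mul_zero]
  rw [h1, h2, zero_smul, zero_smul, add_zero]

/-- A first-order matrix times a second-order one vanishes when `ε² = η² = 0`. [folklore] -/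
theorem sqz_mul_epsEta_smul (hε : ε * ε = 0) (hη : η * η = 0) (P Q : Matrix l m T)
    (M : Matrix m n T) : (ε • P + η • Q) * ((ε * η) • M) = 0 := by
  rw [Matrix.add_mul, Matrix.smul_mul, Matrix.smul_mul, Matrix.mul_smul, Matrix.mul_smul, smul_smul,
    smul_smul]
  have h1 : ε * (ε * η) = 0 := by rw [← mul_assoc, hε, zero_mul]
  have h2 : η * (ε * η) = 0 := by rw [mul_left_comm, hη, mul_zero]
  rw [h1, h2, zero_smul, zero_smul, add_zero]

variable [DecidableEq m]

/-- `det (1 + r M) = 1 + r · tr M` when `r² = 0`. [folklore] -/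
theorem det_one_add_smul_of_mul_self_eq_zero (r : T) (hr : r * r = 0) (M : Matrix m m T) :
    (1 + r • M).det = 1 + r * M.trace := by
  rw [Matrix.det_one_add_smul, pow_two, hr, mul_zero, add_zero, mul_comm]

/-- **Determinant of a unipotent first-order block**: for `ε² = η² = 0`,
`det (1 + ε P + η Q) = (1 + ε tr P)(1 + η tr Q)(1 - εη tr(PQ))`. [folklore] -/
theorem det_one_add_sqz (hε : ε * ε = 0) (hη : η * η = 0) (P Q : Matrix m m T) :
    (1 + (ε • P + η • Q)).det =
      (1 + ε * P.trace) * (1 + η * Q.trace) * (1 - ε * η * (P * Q).trace) := by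
  set δ : T := -(ε * η) with hδ
  have hδδ : δ * δ = 0 := by
    rw [hδ, neg_mul_neg, mul_mul_mul_comm, hε, zero_mul]
  have hδε : δ * ε = 0 := by rw [hδ, neg_mul, mul_right_comm, hε, zero_mul, neg_zero]
  have hδη : δ * η = 0 := by rw [hδ, neg_mul, mul_assoc, hη, mul_zero, neg_zero]
  have hδηε : δ * (η * ε) = 0 := by rw [← mul_assoc, hδη, zero_mul]
  have hfac : (1 : Matrix m m T) + (ε • P + η • Q) =
      (1 + ε • P) * (1 + η • Q) * (1 + δ • (P * Q)) := by
    simp only [Matrix.add_mul, Matrix.mul_add, Matrix.one_mul, Matrix.mul_one, Matrix.smul_mul,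
      Matrix.mul_smul, smul_add, smul_smul, hδε, hδη, hδηε, zero_smul, add_zero]
    rw [hδ, neg_smul, mul_comm η ε]
    abel
  rw [hfac, Matrix.det_mul, Matrix.det_mul, det_one_add_smul_of_mul_self_eq_zero ε hε,
    det_one_add_smul_of_mul_self_eq_zero η hη, det_one_add_smul_of_mul_self_eq_zero δ hδδ, hδ,
    neg_mul, ← sub_eq_add_neg]

/-- `det (S + E) = det S + tr(adj S · E) + det E` for `2 × 2` matrices. [folklore] -/
theorem det_add_fin_two (S E : Matrix (Fin 2) (Fin 2) T) :
    (S + E).det = S.det + (S.adjugate * E).trace + E.det := by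
  simp only [Matrix.det_fin_two, Matrix.adjugate_fin_two, Matrix.trace_fin_two, Matrix.mul_apply,
    Fin.sum_univ_two, Matrix.add_apply, Matrix.of_apply, Matrix.cons_val', Matrix.cons_val_zero,
    Matrix.cons_val_one, Matrix.empty_val', Matrix.cons_val_fin_one]
  ring

/-- `det (ε A + η B - εη C) = εη tr(adj A · B)` for `2 × 2` matrices when `ε² = η² = 0`. [folklore] -/
theorem det_sqz_fin_two (hε : ε * ε = 0) (hη : η * η = 0) (A B C : Matrix (Fin 2) (Fin 2) T) :
    (ε • A + η • B - (ε * η) • C).det = ε * η * (A.adjugate * B).trace := by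
  simp only [Matrix.det_fin_two, Matrix.adjugate_fin_two, Matrix.trace_fin_two, Matrix.mul_apply,
    Fin.sum_univ_two, Matrix.add_apply, Matrix.sub_apply, Matrix.smul_apply, smul_eq_mul,
    Matrix.of_apply, Matrix.cons_val', Matrix.cons_val_zero, Matrix.cons_val_one, Matrix.empty_val',
    Matrix.cons_val_fin_one]
  linear_combination (A 0 0 * A 1 1 - A 0 1 * A 1 0 + η * (-(A 0 0 * C 1 1) + A 0 1 * C 1 0 +
      A 1 0 * C 0 1 - A 1 1 * C 0 0) + η ^ 2 * (C 0 0 * C 1 1 - C 0 1 * C 1 0)) * hε +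
    (B 0 0 * B 1 1 - B 0 1 * B 1 0 + ε * (-(B 0 0 * C 1 1) + B 0 1 * C 1 0 + B 1 0 * C 0 1 -
      B 1 1 * C 0 0)) * hη

omit [DecidableEq m] in
/-- The scalar bookkeeping: `(1 + εa)(1 + ηb)(1 - εηt)(εp + ηq + εηr) = εp + ηq + εη(r + aq + bp)`
when `ε² = η² = 0`. [folklore] -/
theorem sqz_scalar_normalForm (hε : ε * ε = 0) (hη : η * η = 0) (a b t p q r : T) :
    (1 + ε * a) * (1 + η * b) * (1 - ε * η * t) * (ε * p + η * q + ε * η * r) =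
      ε * p + η * q + ε * η * (r + a * q + b * p) := by
  linear_combination (-(a * b * ε * η ^ 2 * p * t) - a * b * ε * η ^ 3 * r * t + a * b * η * p +
      a * b * η ^ 2 * r - a * b * η ^ 3 * q * t - a * ε * η * p * t - a * ε * η ^ 2 * r * t +
      a * η * r - a * η ^ 2 * q * t + a * p - b * η ^ 2 * p * t - b * η ^ 3 * r * t - η * p * t -
      η ^ 2 * r * t) * hε +
    (a * b * ε * q - b * ε * η * q * t + b * ε * r + b * q - ε * q * t) * hη

variable {κ : Type*} [Fintype κ] [DecidableEq κ]

/-- **Second-order expansion of a determinant at a block normal form.**  Over a commutative ring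
with `ε² = η² = 0`, for `S ∈ Mat₂` with `det S = 0` and a perturbation `ε X + η Y` in block form
(`X = (X₁₁ X₁₂; X₂₁ X₂₂)` etc.):
`det (diag(1, S) + ε X + η Y) = ε ζ(X) + η ζ(Y) + εη [τ(X)ζ(Y) + τ(Y)ζ(X) + tr(adj X₂₂ · Y₂₂)
  - tr(adj S · (X₂₁ Y₁₂ + Y₂₁ X₁₂))]`, `τ = tr (·)₁₁`, `ζ = tr(adj S · (·)₂₂)`
(Schur complement `det_fromBlocks₁₁` with the unipotent block inverted by `1 - E + E²`).
[cite: MignonRessayre2004, §2] -/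
theorem det_block_sqz (hε : ε * ε = 0) (hη : η * η = 0) (S : Matrix (Fin 2) (Fin 2) T)
    (hS : S.det = 0) (X₁₁ Y₁₁ : Matrix κ κ T) (X₁₂ Y₁₂ : Matrix κ (Fin 2) T)
    (X₂₁ Y₂₁ : Matrix (Fin 2) κ T) (X₂₂ Y₂₂ : Matrix (Fin 2) (Fin 2) T) :
    (Matrix.fromBlocks (1 + (ε • X₁₁ + η • Y₁₁)) (ε • X₁₂ + η • Y₁₂) (ε • X₂₁ + η • Y₂₁)
        (S + (ε • X₂₂ + η • Y₂₂))).det =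
      ε * (S.adjugate * X₂₂).trace + η * (S.adjugate * Y₂₂).trace +
        ε * η * ((X₂₂.adjugate * Y₂₂).trace - (S.adjugate * (X₂₁ * Y₁₂ + Y₂₁ * X₁₂)).trace +
          X₁₁.trace * (S.adjugate * Y₂₂).trace + Y₁₁.trace * (S.adjugate * X₂₂).trace) := by
  set E : Matrix κ κ T := ε • X₁₁ + η • Y₁₁ with hE
  have hE3 : E * E * E = 0 := by
    rw [hE, sqz_mul_sqz hε hη, epsEta_smul_mul_sqz hε hη]
  letI : Invertible (1 + E) := ⟨1 - E + E * E,
    by rw [show (1 - E + E * E) * (1 + E) = 1 + E * E * E by noncomm_ring, hE3, add_zero],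
    by rw [show (1 + E) * (1 - E + E * E) = 1 + E * E * E by noncomm_ring, hE3, add_zero]⟩
  have hinv : ⅟(1 + E) = 1 - E + E * E := rfl
  rw [Matrix.det_fromBlocks₁₁, hinv]
  -- the Schur complement correction
  have hcorr : (ε • X₂₁ + η • Y₂₁) * (1 - E + E * E) * (ε • X₁₂ + η • Y₁₂) =
      (ε * η) • (X₂₁ * Y₁₂ + Y₂₁ * X₁₂) := by
    have h1 : (ε • X₂₁ + η • Y₂₁) * E = (ε * η) • (X₂₁ * Y₁₁ + Y₂₁ * X₁₁) := by
      rw [hE, sqz_mul_sqz hε hη]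
    have h2 : (ε • X₂₁ + η • Y₂₁) * (1 - E + E * E) =
        ε • X₂₁ + η • Y₂₁ - (ε * η) • (X₂₁ * Y₁₁ + Y₂₁ * X₁₁) := by
      rw [Matrix.mul_add, Matrix.mul_sub, Matrix.mul_one, ← Matrix.mul_assoc, h1, hE,
        epsEta_smul_mul_sqz hε hη, add_zero]
    rw [h2, Matrix.sub_mul, epsEta_smul_mul_sqz hε hη, sub_zero, sqz_mul_sqz hε hη]
  rw [hcorr, hE, det_one_add_sqz hε hη, add_sub_assoc, det_add_fin_two, hS, zero_add,
    det_sqz_fin_two hε hη, Matrix.mul_sub, Matrix.mul_add, Matrix.mul_smul, Matrix.mul_smul,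
    Matrix.mul_smul, Matrix.trace_sub, Matrix.trace_add, Matrix.trace_smul, Matrix.trace_smul,
    Matrix.trace_smul, smul_eq_mul, smul_eq_mul, smul_eq_mul]
  rw [show ε * (S.adjugate * X₂₂).trace + η * (S.adjugate * Y₂₂).trace -
      ε * η * (S.adjugate * (X₂₁ * Y₁₂ + Y₂₁ * X₁₂)).trace + ε * η * (X₂₂.adjugate * Y₂₂).trace =
      ε * (S.adjugate * X₂₂).trace + η * (S.adjugate * Y₂₂).trace +
        ε * η * ((X₂₂.adjugate * Y₂₂).trace - (S.adjugate * (X₂₁ * Y₁₂ + Y₂₁ * X₁₂)).trace) by ring,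
    sqz_scalar_normalForm hε hη]

end SquareZero

end Summit.ValiantsHypothesis.ValiantsHypothesis.Theorems.GrenetZeonPolySizeQPAlgebra

end
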